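/-
Copyright: statement-level skeleton of a published paper (lit-balaban cell, Phase-2 proof seat p37 gen 108). No claims beyond
what the kernel checks below.
-/
import Mathlib
import Literature.MathematicalPhysics.QuantumFieldTheory.Balaban1983to89.B3PairingLineCalculus
import Literature.MathematicalPhysics.QuantumFieldTheory.Balaban1983to89.B3GraphGlue

/-!
# B3 — T. Bałaban, *(Higgs)₂,₃ quantum fields in a finite volume. III. Renormalization*, CMP **88** (1983) 411–445
[Balaban1983Higgs3], pp. 414–416 [PDF 4–6]: **THE CUTTING RULE — the expression E(G) of a graph GLUED from two graphs along
one new scalar line (p37's `B3GraphGlue.glue`) on p26's evaluator `B3GraphAmplitude.amp`: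
E(glue G₁ G₂ a b) = Σ_{p,q} K_new(p,q) · E(G₁)[leg a ↦ δ_p] · E(G₂)[leg b ↦ δ_q]** (FILE K2; FILE K1 = `B3PairingLineCalculus`;
FILE K3 = `B3OnePIChainAmplitude`: the amputated kernels of p37's chains of insertions are the matrix products of (1.21))

statement-level skeleton of published theorems with citation tags; proofs where landed; nothing here is a claim about
the Yang–Mills mass gap

PDF held: `paper:balaban1983-higgs-2-3-quantum-fields-finite-volume` (journal page = PDF page + 410); pp. 414–416 read on the ×2
renders `run/shared/lean/pub/pub-balaban/b2b-balaban-ref1/pages/1983-cmp88-higgs23-III/…-p004,p005,p006-x2.png`.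

CITATION HEADER (lean-in-tree rule).  lit-balaban TYPED SKELETON (HOME `run/shared/lean/pub/lit-balaban/`), PHASE 2, seat p37 gen 108
(unit `lit-balaban-p37`; TAKING (K), HOME/STATUS.md 2026-08-23T12:42:19Z, free-target protocol G.5-34(d)); row **B3.Eq1.19-1.22** of
`HOME/lit-balaban-r15/ROWS-B3.md` ((1.21) p. 416; fold owner r15; head `proved` under the lead's HEAD WORD Q25 2026-08-23T08:24:18Z,
reading (P) — this file is an OPTIONAL located member of its (1.21) cell, zero head weight; the owner's Q28 text 2026-08-23T12:30:56Z
lists *"amputation as an operation on the concrete expansion"* as not in the tree — this file and FILE K3 serve it on p18's model).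
CONSUMES BY NAME, nothing re-declared: p18's `B3Cor23Concrete.Graph`/`Leg` (p239034 lineage); p37's `B3GraphGlueLegs.legL/legR/
glueOther_legL_self/_legR_self/_legL_of_ne/_legR_of_ne` (p362350) and `B3GraphGlue.glue` (p362777); p26's evaluator FILE 1
`B3GraphAmplitude` (`SLeg/VLeg/OLeg`, `SLeg.toLeg`, `sRank/vRank/oRank` + injectivity, `toSLeg?/toVLeg?` + `_eq_some_iff`, `spartner/
vpartner` + `_eq_none_iff`, `sPairing/vPairing`, `SLine/VLine/ExtSLeg/ExtVLeg`, `outSlots`, `Rules`, `OutPairing`, `vertexFactor`,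
`sLineFactor/vLineFactor/oLineFactor`, **`amp`**; p361338); FILE K1 `B3PairingLineCalculus` (`pairK`, `lineK`, `lineProd`, `jointK`,
`Pairing.glueP/sumP/transportP`, `sumRank`, `lineProd_rank_indep`, `lineProd_transport`, `lineProd_glueP_jointK`, `lineProd_sumP_jointK`,
`flipSymm_transport`, `jointK_flipSymm_glueP/_sumP`, `pairK_flipSymm`).

THE PRINTED TEXT (verbatim).  p. 414 [PDF 4]: *"All the A′-legs are contracted, i.e. they are divided into pairs and each pair is
replaced by the corresponding propagator. Some φ′-legs are replaced by external scalar fields and the remaining are again divided into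
pairs and each pair is replaced by a propagator, i.e. by G_k(Ω,B̃), G_k(Ω₂,B̃), δG_k(Ω,Ω₂,B̃) or the operator (1.16)."*; p. 416 [PDF 6],
(1.21): *"G^ε = Σ_{n=0}^{∞} C^ε_0[(−δm² + Σ^ε + ∂^{ε*}Σ^ε_1 + Σ^{ε*}_1∂^ε + ∂^{ε*}Σ^ε_2∂^ε)C^ε_0]ⁿ, (1.21) where C^ε_0 = (−Δ^ε_0 + m²)^{−1}
and Σ^ε, Σ^ε_1, Σ^ε_2 are given by amputated, one-particle-irreducible graphs of the expansion of G^ε."*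

WHAT THIS FILE PROVES.  The term `C₀^ε X C₀^ε X ⋯` of (1.21) is the VALUE of a connected two-point graph read as a chain of its
1PI pieces joined by single propagator lines; the step from the graph to the product is the rule, implicit in p. 414's *"each pair is
replaced by the corresponding propagator"*, that CUTTING one internal line of a graph leaves the two pieces with one more external leg
each, the cut line's propagator contracting the two exposed legs.  On p18's model with p26's evaluator this reads: for the glued graph
`glue G₁ G₂ a b` (p37: the lines of `G₁`, the lines of `G₂`, ONE NEW LINE between the external φ′-leg `a` of `G₁` and the external
φ′-leg `b` of `G₂`), with the vertex rules of the two pieces (`glueRules`), the old line kernels and the new line's kernel `Knew`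
(`glueKs`; `glueKv`, `glueKo`: no new vector line, no new output pair — `gluePo`), and external data that are PRODUCTS of data for
the two pieces (the external legs of the glued graph being those of `G₁` other than `a` and those of `G₂` other than `b`: `extL`,
`extR`, `extVL`, `extVR`, `extOL`, `extOR`), **`amp_glue`**: E(glue G₁ G₂ a b) = Σ_{p,q} Knew p q · E(G₁)[a ↦ δ_p] · E(G₂)[b ↦ δ_q],
where E(G₁)[a ↦ δ_p] is p26's `amp` of `G₁` with the external function restricted to the assignments sending `a` to the index `p`
(the coordinate `p = (x, i)` of the exposed leg: the amplitude of `G₁` as a KERNEL in its leg `a`).  Ingredients: §1 the legs of one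
fibre-size function under juxtaposition (`FLeg`, `flegL/flegR/unfleg/flegEquiv` — p37's `legEquiv` per species); §2 the φ′-leg of a
scalar `Leg` (`sleg`), the species maps under juxtaposition (`toLeg_flegL_s`, …, `toSLeg?_map_legL`, …); §3 the scalar/vector pairings of
the glued graph ARE the glued/juxtaposed pairings of FILE K1 transported along `flegEquiv` (`spartner_glue`, `vpartner_glue`), the
output pairing `gluePo`; §4 `glueRules`, the joined index assignments `joinS/joinV/joinO` and the reindexing of the assignment sums
(`sum_joinS/V/O`), `vertexFactor_glue`; §5 `glueKs/glueKv/glueKo` and the line factors of the glued graph (`sLineFactor_glue` — the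
new line's kernel appears —, `vLineFactor_glue`, `oLineFactor_glue`); §6 the external legs; §7 linearity of `amp` in the external
scalar function in the form needed (`amp_sum_mul_extS`, Kronecker collapse) and **`amp_glue`**.
HONEST SCOPE.  (a) The new line is a SCALAR line (`a`, `b` φ′-legs), as in (1.21); gluing along an A′-line would be the same
bookkeeping with `vPairing` glued and `sPairing` juxtaposed (not needed, not done).  (b) The (1.18) output pairing of the glued graph is
the juxtaposition of the pieces' pairings (no output of `G₁` is paired with an output of `G₂`): p18's `Graph` does not record output
pairs, and in (1.21) the pieces are joined by ONE propagator line only.  (c) External data of product form across the two pieces (joint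
*"functions of many variables"*, p. 419, WITHIN each piece are allowed); general joint data across the cut are sums of products and follow
by linearity (`amp_add_extS`, FILE 1) — not spelled out.  (d) Index form only: kernels and rules are parameters, nothing about them is
used; no convergence, no estimate.  Definitions with bodies + theorems; no `Prop` fact, no `sorry`; standard axioms.  Unit
`lit-balaban-p37` gen 108 (literature-prover-lit-balaban-p37-g108-0), HOME `run/shared/lean/pub/lit-balaban/`, 2026-08-23.
-/

open Finset
open scoped BigOperators

namespace Literature.MathematicalPhysics.QuantumFieldTheory.Balaban1983to89.B3GraphGlueAmplitude

open B3Prop1 B3Cor23Concrete B3GraphGlueLegs B3GraphGlue B3GraphAmplitude B3PairingLineCalculus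

/-! ## §1 The legs of one fibre-size function under juxtaposition of two vertex families -/

section FLegs

/-- The legs of the vertex family `kind` for a FIBRE-SIZE function `f` on the catalogue (`f = scalarLegs`: p26's `SLeg`;
`f = vectorLegs`: `VLeg`; `f = outSlots`: `OLeg`). [cite: Balaban1983Higgs3, (1.17) p.415] -/
abbrev FLeg {n : ℕ} (f : VertexKind → ℕ) (kind : Fin n → VertexKind) : Type := Σ i : Fin n, Fin (f (kind i))

variable {n₁ n₂ : ℕ} (f : VertexKind → ℕ) (k₁ : Fin n₁ → VertexKind) (k₂ : Fin n₂ → VertexKind)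

/-- kernel: iterated re-indexing of a slot along two equalities that compose to `rfl` is the identity. [folklore] -/
@[simp] private theorem fin_cast_cast_self {n m : ℕ} (h : n = m) (h' : m = n) (i : Fin n) : Fin.cast h' (Fin.cast h i) = i :=
  Fin.ext rfl

/-- A leg of the first family as a leg of the juxtaposed family `Fin.append k₁ k₂` (vertex `Fin.castAdd`; p37's `legL` per species).
[cite: Balaban1983Higgs3, (1.17) p.415] -/
def flegL (x : FLeg f k₁) : FLeg f (Fin.append k₁ k₂) :=
  ⟨Fin.castAdd n₂ x.1, Fin.cast (by rw [Fin.append_left]) x.2⟩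

/-- A leg of the second family as a leg of the juxtaposed family (vertex `Fin.natAdd`; p37's `legR` per species).
[cite: Balaban1983Higgs3, (1.17) p.415] -/
def flegR (y : FLeg f k₂) : FLeg f (Fin.append k₁ k₂) :=
  ⟨Fin.natAdd n₁ y.1, Fin.cast (by rw [Fin.append_right]) y.2⟩

/-- Splitting a leg of the juxtaposed family by the side of its vertex (p37's `unglue` per species). [cite: Balaban1983Higgs3, (1.17) p.415] -/
def unfleg (z : FLeg f (Fin.append k₁ k₂)) : FLeg f k₁ ⊕ FLeg f k₂ :=
  Fin.addCases (motive := fun v => Fin (f (Fin.append k₁ k₂ v)) → FLeg f k₁ ⊕ FLeg f k₂)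
    (fun i s => Sum.inl ⟨i, Fin.cast (by rw [Fin.append_left]) s⟩)
    (fun j s => Sum.inr ⟨j, Fin.cast (by rw [Fin.append_right]) s⟩) z.1 z.2

/-- kernel: splitting recovers a leg of the first family. [cite: Balaban1983Higgs3, (1.17) p.415] -/
@[simp] theorem unfleg_flegL (x : FLeg f k₁) : unfleg f k₁ k₂ (flegL f k₁ k₂ x) = Sum.inl x := by
  obtain ⟨i, s⟩ := x
  simp [unfleg, flegL, Fin.addCases_left]

/-- kernel: splitting recovers a leg of the second family. [cite: Balaban1983Higgs3, (1.17) p.415] -/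
@[simp] theorem unfleg_flegR (y : FLeg f k₂) : unfleg f k₁ k₂ (flegR f k₁ k₂ y) = Sum.inr y := by
  obtain ⟨j, s⟩ := y
  simp [unfleg, flegR, Fin.addCases_right]

/-- kernel: every leg of the juxtaposed family comes from exactly one side. [cite: Balaban1983Higgs3, (1.17) p.415] -/
theorem elim_unfleg (z : FLeg f (Fin.append k₁ k₂)) : Sum.elim (flegL f k₁ k₂) (flegR f k₁ k₂) (unfleg f k₁ k₂ z) = z := by
  obtain ⟨v, s⟩ := z
  induction v using Fin.addCases with
  | left i => simp [unfleg, Fin.addCases_left, flegL]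
  | right j => simp [unfleg, Fin.addCases_right, flegR]

/-- **The legs of size `f` of the juxtaposed family are those of the two families**: `FLeg f k₁ ⊕ FLeg f k₂ ≃ FLeg f (Fin.append k₁ k₂)`.
[cite: Balaban1983Higgs3, (1.17) p.415] -/
def flegEquiv : FLeg f k₁ ⊕ FLeg f k₂ ≃ FLeg f (Fin.append k₁ k₂) where
  toFun := Sum.elim (flegL f k₁ k₂) (flegR f k₁ k₂)
  invFun := unfleg f k₁ k₂
  left_inv := by rintro (x | y) <;> simp
  right_inv := elim_unfleg f k₁ k₂

/-- kernel. [cite: Balaban1983Higgs3, (1.17) p.415] -/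
@[simp] theorem flegEquiv_inl (x : FLeg f k₁) : flegEquiv f k₁ k₂ (Sum.inl x) = flegL f k₁ k₂ x := rfl

/-- kernel. [cite: Balaban1983Higgs3, (1.17) p.415] -/
@[simp] theorem flegEquiv_inr (y : FLeg f k₂) : flegEquiv f k₁ k₂ (Sum.inr y) = flegR f k₁ k₂ y := rfl

/-- kernel. [cite: Balaban1983Higgs3, (1.17) p.415] -/
@[simp] theorem flegEquiv_symm_flegL (x : FLeg f k₁) : (flegEquiv f k₁ k₂).symm (flegL f k₁ k₂ x) = Sum.inl x :=
  unfleg_flegL f k₁ k₂ x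

/-- kernel. [cite: Balaban1983Higgs3, (1.17) p.415] -/
@[simp] theorem flegEquiv_symm_flegR (y : FLeg f k₂) : (flegEquiv f k₁ k₂).symm (flegR f k₁ k₂ y) = Sum.inr y :=
  unfleg_flegR f k₁ k₂ y

/-- kernel: a left leg is never a right leg. [cite: Balaban1983Higgs3, (1.17) p.415] -/
theorem flegL_ne_flegR (x : FLeg f k₁) (y : FLeg f k₂) : flegL f k₁ k₂ x ≠ flegR f k₁ k₂ y := fun h => by
  simpa using congrArg (unfleg f k₁ k₂) h

/-- kernel: `flegL` is injective. [cite: Balaban1983Higgs3, (1.17) p.415] -/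
theorem flegL_injective : Function.Injective (flegL f k₁ k₂) := fun x x' h => by
  simpa using congrArg (unfleg f k₁ k₂) h

/-- kernel: `flegR` is injective. [cite: Balaban1983Higgs3, (1.17) p.415] -/
theorem flegR_injective : Function.Injective (flegR f k₁ k₂) := fun y y' h => by
  simpa using congrArg (unfleg f k₁ k₂) h

end FLegs

/-! ## §2 Scalar legs of p18's `Leg`; the species maps under juxtaposition -/

section Species

variable {n : ℕ} {kind : Fin n → VertexKind}

/-- The φ′-leg underlying a leg of p18's model known to be scalar (`isLeft`). [cite: Balaban1983Higgs3, (1.17) p.415] -/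
def sleg (x : Leg kind) (h : x.2.isLeft = true) : SLeg kind := ⟨x.1, x.2.getLeft h⟩

/-- kernel: the φ′-leg of a scalar leg is that leg. [cite: Balaban1983Higgs3, (1.17) p.415] -/
@[simp] theorem toLeg_sleg (x : Leg kind) (h : x.2.isLeft = true) : (sleg x h).toLeg = x := by
  obtain ⟨i, s⟩ := x
  simp only [sleg, SLeg.toLeg, Sigma.mk.injEq, heq_eq_eq, true_and]
  exact Sum.inl_getLeft s h

/-- kernel: `SLeg.toLeg` is injective. [cite: Balaban1983Higgs3, (1.17) p.415] -/
theorem sLeg_toLeg_injective : Function.Injective (SLeg.toLeg (kind := kind)) := by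
  rintro ⟨i, j⟩ ⟨i', j'⟩ h
  simp only [SLeg.toLeg, Sigma.mk.injEq] at h
  obtain ⟨rfl, hj⟩ := h
  have := eq_of_heq hj
  simp only [Sum.inl.injEq] at this
  subst this
  rfl

/-- kernel: `VLeg.toLeg` is injective. [cite: Balaban1983Higgs3, (1.17) p.415] -/
theorem vLeg_toLeg_injective : Function.Injective (VLeg.toLeg (kind := kind)) := by
  rintro ⟨i, j⟩ ⟨i', j'⟩ h
  simp only [VLeg.toLeg, Sigma.mk.injEq] at h
  obtain ⟨rfl, hj⟩ := h
  have := eq_of_heq hj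
  simp only [Sum.inr.injEq] at this
  subst this
  rfl

section GraphFacts

variable {nbar : ℕ} {G : Graph nbar}

/-- kernel: the φ′-leg of an external scalar leg is external in the scalar pairing. [cite: Balaban1983Higgs3, (1.17) p.415] -/
theorem spartner_sleg {x : Leg G.kind} (hx : G.other x = none) (h : x.2.isLeft = true) : spartner G (sleg x h) = none := by
  rw [spartner_eq_none_iff, toLeg_sleg]
  exact hx

/-- kernel: the scalar pairing's `other` is `spartner`. [cite: Balaban1983Higgs3, p.415] -/
theorem sPairing_other : (sPairing G).other = spartner G := rfl

/-- kernel: the vector pairing's `other` is `vpartner`. [cite: Balaban1983Higgs3, p.415] -/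
theorem vPairing_other : (vPairing G).other = vpartner G := rfl

/-- kernel: unfolding `spartner`. [cite: Balaban1983Higgs3, p.415] -/
theorem spartner_def (ℓ : SLeg G.kind) : spartner G ℓ = toSLeg? (G.other ℓ.toLeg) := rfl

/-- kernel: unfolding `vpartner`. [cite: Balaban1983Higgs3, p.415] -/
theorem vpartner_def (ℓ : VLeg G.kind) : vpartner G ℓ = toVLeg? (G.other ℓ.toLeg) := rfl

end GraphFacts

variable {n₁ n₂ : ℕ} (k₁ : Fin n₁ → VertexKind) (k₂ : Fin n₂ → VertexKind)

/-- kernel: the φ′-leg embedding of the first side is p37's `legL` on φ′-legs. [cite: Balaban1983Higgs3, (1.17) p.415] -/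
theorem toLeg_flegL_s (x : SLeg k₁) : SLeg.toLeg (flegL VertexKind.scalarLegs k₁ k₂ x) = legL k₁ k₂ x.toLeg := rfl

/-- kernel: the φ′-leg embedding of the second side is p37's `legR` on φ′-legs. [cite: Balaban1983Higgs3, (1.17) p.415] -/
theorem toLeg_flegR_s (y : SLeg k₂) : SLeg.toLeg (flegR VertexKind.scalarLegs k₁ k₂ y) = legR k₁ k₂ y.toLeg := rfl

/-- kernel: the A′-leg embedding of the first side is p37's `legL` on A′-legs. [cite: Balaban1983Higgs3, (1.17) p.415] -/
theorem toLeg_flegL_v (x : VLeg k₁) : VLeg.toLeg (flegL VertexKind.vectorLegs k₁ k₂ x) = legL k₁ k₂ x.toLeg := rfl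

/-- kernel: the A′-leg embedding of the second side is p37's `legR` on A′-legs. [cite: Balaban1983Higgs3, (1.17) p.415] -/
theorem toLeg_flegR_v (y : VLeg k₂) : VLeg.toLeg (flegR VertexKind.vectorLegs k₁ k₂ y) = legR k₁ k₂ y.toLeg := rfl

/-- kernel: reading φ′-legs commutes with the left embedding. [cite: Balaban1983Higgs3, (1.17) p.415] -/
theorem toSLeg?_map_legL (o : Option (Leg k₁)) :
    toSLeg? (o.map (legL k₁ k₂)) = (toSLeg? o).map (flegL VertexKind.scalarLegs k₁ k₂) := by
  rcases o with _ | ⟨i, j | j⟩ <;> rfl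

/-- kernel: reading φ′-legs commutes with the right embedding. [cite: Balaban1983Higgs3, (1.17) p.415] -/
theorem toSLeg?_map_legR (o : Option (Leg k₂)) :
    toSLeg? (o.map (legR k₁ k₂)) = (toSLeg? o).map (flegR VertexKind.scalarLegs k₁ k₂) := by
  rcases o with _ | ⟨i, j | j⟩ <;> rfl

/-- kernel: reading A′-legs commutes with the left embedding. [cite: Balaban1983Higgs3, (1.17) p.415] -/
theorem toVLeg?_map_legL (o : Option (Leg k₁)) :
    toVLeg? (o.map (legL k₁ k₂)) = (toVLeg? o).map (flegL VertexKind.vectorLegs k₁ k₂) := by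
  rcases o with _ | ⟨i, j | j⟩ <;> rfl

/-- kernel: reading A′-legs commutes with the right embedding. [cite: Balaban1983Higgs3, (1.17) p.415] -/
theorem toVLeg?_map_legR (o : Option (Leg k₂)) :
    toVLeg? (o.map (legR k₁ k₂)) = (toVLeg? o).map (flegR VertexKind.vectorLegs k₁ k₂) := by
  rcases o with _ | ⟨i, j | j⟩ <;> rfl

end Species

/-! ## §3 The pairings of the glued graph are the glued / juxtaposed pairings of FILE K1 -/

section Glued

variable {nbar : ℕ} {G₁ G₂ : Graph nbar} {a : Leg G₁.kind} {b : Leg G₂.kind} {ha : G₁.other a = none}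
  {hb : G₂.other b = none} {hab : a.2.isLeft = b.2.isLeft} (hsa : a.2.isLeft = true) (hsb : b.2.isLeft = true)

/-- The glued graph of this file's statements: p37's `glue G₁ G₂ a b` (abbreviation for readability). [cite: Balaban1983Higgs3, (1.21) p.416] -/
local notation "GG" => glue G₁ G₂ a b ha hb hab

/-- The relabelling of the φ′-legs of the glued graph. [cite: Balaban1983Higgs3, (1.17) p.415] -/
abbrev eS : SLeg G₁.kind ⊕ SLeg G₂.kind ≃ SLeg (Fin.append G₁.kind G₂.kind) := flegEquiv VertexKind.scalarLegs G₁.kind G₂.kind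

/-- The relabelling of the A′-legs of the glued graph. [cite: Balaban1983Higgs3, (1.17) p.415] -/
abbrev eV : VLeg G₁.kind ⊕ VLeg G₂.kind ≃ VLeg (Fin.append G₁.kind G₂.kind) := flegEquiv VertexKind.vectorLegs G₁.kind G₂.kind

/-- The relabelling of the output slots of the glued graph. [cite: Balaban1983Higgs3, (1.18) p.415] -/
abbrev eO : OLeg G₁.kind ⊕ OLeg G₂.kind ≃ OLeg (Fin.append G₁.kind G₂.kind) := flegEquiv outSlots G₁.kind G₂.kind

/-- FILE K1's glued scalar pairing for the two pieces and the cut φ′-legs `a`, `b`. [cite: Balaban1983Higgs3, (1.21) p.416] -/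
abbrev jointS : Pairing (SLeg G₁.kind ⊕ SLeg G₂.kind) :=
  (sPairing G₁).glueP (sPairing G₂) (sleg a hsa) (sleg b hsb) (spartner_sleg ha hsa) (spartner_sleg hb hsb)

/-- **The scalar pairing of the glued graph IS FILE K1's glued pairing, relabelled**: `spartner (glue G₁ G₂ a b) (eS w) =
(jointS.other w).map eS`. [cite: Balaban1983Higgs3, (1.21) p.416] -/
theorem spartner_glue (w : SLeg G₁.kind ⊕ SLeg G₂.kind) :
    (sPairing GG).other (eS w) = ((jointS (ha := ha) (hb := hb) hsa hsb).other w).map eS := by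
  rcases w with x | y
  · by_cases hx : x = sleg a hsa
    · subst hx
      rw [glueP_other_inl_self, Option.map_some, flegEquiv_inr, flegEquiv_inl, sPairing_other, spartner_def, toLeg_flegL_s,
        toLeg_sleg, glue_other, glueOther_legL_self]
      exact (toSLeg?_eq_some_iff _ _).2 (by rw [toLeg_flegR_s, toLeg_sleg])
    · have hx' : x.toLeg ≠ a := fun h => hx (sLeg_toLeg_injective (by rw [h, toLeg_sleg]))
      rw [glueP_other_inl_of_ne _ _ _ _ hx, flegEquiv_inl, sPairing_other, spartner_def, toLeg_flegL_s, glue_other,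
        glueOther_legL_of_ne hx', toSLeg?_map_legL, sPairing_other, spartner_def, Option.map_map]
      rfl
  · by_cases hy : y = sleg b hsb
    · subst hy
      rw [glueP_other_inr_self, Option.map_some, flegEquiv_inl, flegEquiv_inr, sPairing_other, spartner_def, toLeg_flegR_s,
        toLeg_sleg, glue_other, glueOther_legR_self]
      exact (toSLeg?_eq_some_iff _ _).2 (by rw [toLeg_flegL_s, toLeg_sleg])
    · have hy' : y.toLeg ≠ b := fun h => hy (sLeg_toLeg_injective (by rw [h, toLeg_sleg]))
      rw [glueP_other_inr_of_ne _ _ _ _ hy, flegEquiv_inr, sPairing_other, spartner_def, toLeg_flegR_s, glue_other,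
        glueOther_legR_of_ne hy', toSLeg?_map_legR, sPairing_other, spartner_def, Option.map_map]
      rfl

include hsa hsb in
/-- **The vector pairing of the glued graph is the juxtaposition of the pieces' vector pairings, relabelled** (no new A′-line;
`hsa`, `hsb`: the cut legs are scalar, so every A′-leg is an old leg). [cite: Balaban1983Higgs3, (1.21) p.416] -/
theorem vpartner_glue (w : VLeg G₁.kind ⊕ VLeg G₂.kind) :
    (vPairing GG).other (eV w) = (((vPairing G₁).sumP (vPairing G₂)).other w).map eV := by
  rcases w with x | y
  · have hx' : x.toLeg ≠ a := by
      intro h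
      have h1 : a.2.isLeft = false := by rw [← h]; rfl
      rw [hsa] at h1
      cases h1
    rw [sumP_other_inl, flegEquiv_inl, vPairing_other, vpartner_def, toLeg_flegL_v, glue_other, glueOther_legL_of_ne hx',
      toVLeg?_map_legL, vPairing_other, vpartner_def, Option.map_map]
    rfl
  · have hy' : y.toLeg ≠ b := by
      intro h
      have h1 : b.2.isLeft = false := by rw [← h]; rfl
      rw [hsb] at h1
      cases h1
    rw [sumP_other_inr, flegEquiv_inr, vPairing_other, vpartner_def, toLeg_flegR_v, glue_other, glueOther_legR_of_ne hy',
      toVLeg?_map_legR, vPairing_other, vpartner_def, Option.map_map]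
    rfl

/-- **The (1.18) output pairing of the glued graph**: the juxtaposition of the pieces' output pairings (no output of `G₁` paired
with one of `G₂`), relabelled. [cite: Balaban1983Higgs3, (1.18) p.415] -/
def gluePo (Po₁ : OutPairing G₁) (Po₂ : OutPairing G₂) : OutPairing GG :=
  (Po₁.sumP Po₂).transportP eO

end Glued

/-! ## §4 Vertex rules of the glued graph; joined index assignments; the vertex factor splits -/

section Rules

variable {nbar : ℕ} {G₁ G₂ : Graph nbar} {a : Leg G₁.kind} {b : Leg G₂.kind} {ha : G₁.other a = none}
  {hb : G₂.other b = none} {hab : a.2.isLeft = b.2.isLeft} {SF VF OF : Type*}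

local notation "GG" => glue G₁ G₂ a b ha hb hab

/-- **The vertex rules of the glued graph**: the rules of `G₁` on its vertices, those of `G₂` on its vertices (the slots re-indexed
along `Fin.append`). [cite: Balaban1983Higgs3, (1.6)–(1.15) pp.413–414] -/
def glueRules (V₁ : Rules G₁ SF VF OF) (V₂ : Rules G₂ SF VF OF) : Rules GG SF VF OF := fun v =>
  Fin.addCases (motive := fun v : Fin (G₁.nV + G₂.nV) =>
      (Fin (Fin.append G₁.kind G₂.kind v).scalarLegs → SF) → (Fin (Fin.append G₁.kind G₂.kind v).vectorLegs → VF) →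
        (Fin (outSlots (Fin.append G₁.kind G₂.kind v)) → OF) → ℝ)
    (fun i fs fv fo => V₁ i (fun j => fs (flegL VertexKind.scalarLegs G₁.kind G₂.kind ⟨i, j⟩).2)
      (fun j => fv (flegL VertexKind.vectorLegs G₁.kind G₂.kind ⟨i, j⟩).2)
      (fun j => fo (flegL outSlots G₁.kind G₂.kind ⟨i, j⟩).2))
    (fun i fs fv fo => V₂ i (fun j => fs (flegR VertexKind.scalarLegs G₁.kind G₂.kind ⟨i, j⟩).2)
      (fun j => fv (flegR VertexKind.vectorLegs G₁.kind G₂.kind ⟨i, j⟩).2)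
      (fun j => fo (flegR outSlots G₁.kind G₂.kind ⟨i, j⟩).2)) v

/-- kernel: the glued rules on a vertex of the first piece. [cite: Balaban1983Higgs3, (1.6)–(1.15) pp.413–414] -/
theorem glueRules_castAdd (V₁ : Rules G₁ SF VF OF) (V₂ : Rules G₂ SF VF OF) (i : Fin G₁.nV)
    (fs : Fin (Fin.append G₁.kind G₂.kind (Fin.castAdd G₂.nV i)).scalarLegs → SF)
    (fv : Fin (Fin.append G₁.kind G₂.kind (Fin.castAdd G₂.nV i)).vectorLegs → VF)
    (fo : Fin (outSlots (Fin.append G₁.kind G₂.kind (Fin.castAdd G₂.nV i))) → OF) :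
    glueRules (ha := ha) (hb := hb) (hab := hab) V₁ V₂ (Fin.castAdd G₂.nV i) fs fv fo =
      V₁ i (fun j => fs (flegL VertexKind.scalarLegs G₁.kind G₂.kind ⟨i, j⟩).2)
        (fun j => fv (flegL VertexKind.vectorLegs G₁.kind G₂.kind ⟨i, j⟩).2)
        (fun j => fo (flegL outSlots G₁.kind G₂.kind ⟨i, j⟩).2) := by
  unfold glueRules
  rw [Fin.addCases_left]

/-- kernel: the glued rules on a vertex of the second piece. [cite: Balaban1983Higgs3, (1.6)–(1.15) pp.413–414] -/
theorem glueRules_natAdd (V₁ : Rules G₁ SF VF OF) (V₂ : Rules G₂ SF VF OF) (i : Fin G₂.nV)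
    (fs : Fin (Fin.append G₁.kind G₂.kind (Fin.natAdd G₁.nV i)).scalarLegs → SF)
    (fv : Fin (Fin.append G₁.kind G₂.kind (Fin.natAdd G₁.nV i)).vectorLegs → VF)
    (fo : Fin (outSlots (Fin.append G₁.kind G₂.kind (Fin.natAdd G₁.nV i))) → OF) :
    glueRules (ha := ha) (hb := hb) (hab := hab) V₁ V₂ (Fin.natAdd G₁.nV i) fs fv fo =
      V₂ i (fun j => fs (flegR VertexKind.scalarLegs G₁.kind G₂.kind ⟨i, j⟩).2)
        (fun j => fv (flegR VertexKind.vectorLegs G₁.kind G₂.kind ⟨i, j⟩).2)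
        (fun j => fo (flegR outSlots G₁.kind G₂.kind ⟨i, j⟩).2) := by
  unfold glueRules
  rw [Fin.addCases_right]

variable {IS IV IO : Type*}

/-- The JOINED scalar index assignment of the glued graph from assignments of the two pieces. [cite: Balaban1983Higgs3, p.414] -/
def joinS (α₁ : SLeg G₁.kind → IS) (α₂ : SLeg G₂.kind → IS) : SLeg (Fin.append G₁.kind G₂.kind) → IS :=
  fun z => Sum.elim α₁ α₂ ((flegEquiv VertexKind.scalarLegs G₁.kind G₂.kind).symm z)

/-- The joined vector index assignment. [cite: Balaban1983Higgs3, p.414] -/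
def joinV (β₁ : VLeg G₁.kind → IV) (β₂ : VLeg G₂.kind → IV) : VLeg (Fin.append G₁.kind G₂.kind) → IV :=
  fun z => Sum.elim β₁ β₂ ((flegEquiv VertexKind.vectorLegs G₁.kind G₂.kind).symm z)

/-- The joined output index assignment. [cite: Balaban1983Higgs3, (1.18) p.415] -/
def joinO (ο₁ : OLeg G₁.kind → IO) (ο₂ : OLeg G₂.kind → IO) : OLeg (Fin.append G₁.kind G₂.kind) → IO :=
  fun z => Sum.elim ο₁ ο₂ ((flegEquiv outSlots G₁.kind G₂.kind).symm z)

/-- kernel. [cite: Balaban1983Higgs3, p.414] -/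
@[simp] theorem joinS_flegL (α₁ : SLeg G₁.kind → IS) (α₂ : SLeg G₂.kind → IS) (x : SLeg G₁.kind) :
    joinS α₁ α₂ (flegL VertexKind.scalarLegs G₁.kind G₂.kind x) = α₁ x := by simp [joinS]

/-- kernel. [cite: Balaban1983Higgs3, p.414] -/
@[simp] theorem joinS_flegR (α₁ : SLeg G₁.kind → IS) (α₂ : SLeg G₂.kind → IS) (y : SLeg G₂.kind) :
    joinS α₁ α₂ (flegR VertexKind.scalarLegs G₁.kind G₂.kind y) = α₂ y := by simp [joinS]

/-- kernel. [cite: Balaban1983Higgs3, p.414] -/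
@[simp] theorem joinV_flegL (β₁ : VLeg G₁.kind → IV) (β₂ : VLeg G₂.kind → IV) (x : VLeg G₁.kind) :
    joinV β₁ β₂ (flegL VertexKind.vectorLegs G₁.kind G₂.kind x) = β₁ x := by simp [joinV]

/-- kernel. [cite: Balaban1983Higgs3, p.414] -/
@[simp] theorem joinV_flegR (β₁ : VLeg G₁.kind → IV) (β₂ : VLeg G₂.kind → IV) (y : VLeg G₂.kind) :
    joinV β₁ β₂ (flegR VertexKind.vectorLegs G₁.kind G₂.kind y) = β₂ y := by simp [joinV]

/-- kernel. [cite: Balaban1983Higgs3, (1.18) p.415] -/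
@[simp] theorem joinO_flegL (ο₁ : OLeg G₁.kind → IO) (ο₂ : OLeg G₂.kind → IO) (x : OLeg G₁.kind) :
    joinO ο₁ ο₂ (flegL outSlots G₁.kind G₂.kind x) = ο₁ x := by simp [joinO]

/-- kernel. [cite: Balaban1983Higgs3, (1.18) p.415] -/
@[simp] theorem joinO_flegR (ο₁ : OLeg G₁.kind → IO) (ο₂ : OLeg G₂.kind → IO) (y : OLeg G₂.kind) :
    joinO ο₁ ο₂ (flegR outSlots G₁.kind G₂.kind y) = ο₂ y := by simp [joinO]

/-- kernel. [cite: Balaban1983Higgs3, p.414] -/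
@[simp] theorem joinS_eS_symm (α₁ : SLeg G₁.kind → IS) (α₂ : SLeg G₂.kind → IS) (w : SLeg G₁.kind ⊕ SLeg G₂.kind) :
    joinS α₁ α₂ (flegEquiv VertexKind.scalarLegs G₁.kind G₂.kind w) = Sum.elim α₁ α₂ w := by
  simp [joinS]

/-- kernel. [cite: Balaban1983Higgs3, p.414] -/
@[simp] theorem joinV_eV_symm (β₁ : VLeg G₁.kind → IV) (β₂ : VLeg G₂.kind → IV) (w : VLeg G₁.kind ⊕ VLeg G₂.kind) :
    joinV β₁ β₂ (flegEquiv VertexKind.vectorLegs G₁.kind G₂.kind w) = Sum.elim β₁ β₂ w := by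
  simp [joinV]

/-- kernel. [cite: Balaban1983Higgs3, (1.18) p.415] -/
@[simp] theorem joinO_eO_symm (ο₁ : OLeg G₁.kind → IO) (ο₂ : OLeg G₂.kind → IO) (w : OLeg G₁.kind ⊕ OLeg G₂.kind) :
    joinO ο₁ ο₂ (flegEquiv outSlots G₁.kind G₂.kind w) = Sum.elim ο₁ ο₂ w := by
  simp [joinO]

/-- kernel: a sum over the functions on a type split by an equivalence `A ⊕ B ≃ C` is the double sum over the functions on the
two summands. [folklore] -/
private theorem sum_join {A B C I : Type*} [Fintype A] [Fintype B] [Fintype C] [Fintype I] [DecidableEq A] [DecidableEq B]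
    [DecidableEq C] (e : A ⊕ B ≃ C) (f : (C → I) → ℝ) :
    ∑ γ : C → I, f γ = ∑ α₁ : A → I, ∑ α₂ : B → I, f (fun z => Sum.elim α₁ α₂ (e.symm z)) := by
  rw [← Fintype.sum_prod_type']
  refine Fintype.sum_equiv ((Equiv.arrowCongr e (Equiv.refl I)).symm.trans (Equiv.sumArrowEquivProdArrow A B I)) _ _
    fun γ => ?_
  congr 1
  funext z
  obtain ⟨w, rfl⟩ := e.surjective z
  rcases w with x | y <;> simp [Equiv.sumArrowEquivProdArrow, Equiv.arrowCongr]

variable [Fintype IS] [Fintype IV] [Fintype IO]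

/-- kernel: the scalar assignments of the glued graph are the pairs of assignments of the pieces. [cite: Balaban1983Higgs3, p.414] -/
theorem sum_joinS (f : (SLeg (Fin.append G₁.kind G₂.kind) → IS) → ℝ) :
    ∑ γ, f γ = ∑ α₁ : SLeg G₁.kind → IS, ∑ α₂ : SLeg G₂.kind → IS, f (joinS α₁ α₂) :=
  sum_join (flegEquiv VertexKind.scalarLegs G₁.kind G₂.kind) f

/-- kernel: the vector assignments of the glued graph are the pairs of assignments of the pieces. [cite: Balaban1983Higgs3, p.414] -/
theorem sum_joinV (f : (VLeg (Fin.append G₁.kind G₂.kind) → IV) → ℝ) :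
    ∑ γ, f γ = ∑ β₁ : VLeg G₁.kind → IV, ∑ β₂ : VLeg G₂.kind → IV, f (joinV β₁ β₂) :=
  sum_join (flegEquiv VertexKind.vectorLegs G₁.kind G₂.kind) f

/-- kernel: the output assignments of the glued graph are the pairs of assignments of the pieces. [cite: Balaban1983Higgs3, (1.18) p.415] -/
theorem sum_joinO (f : (OLeg (Fin.append G₁.kind G₂.kind) → IO) → ℝ) :
    ∑ γ, f γ = ∑ ο₁ : OLeg G₁.kind → IO, ∑ ο₂ : OLeg G₂.kind → IO, f (joinO ο₁ ο₂) :=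
  sum_join (flegEquiv outSlots G₁.kind G₂.kind) f

omit [Fintype IS] [Fintype IV] [Fintype IO] in
/-- **The vertex factor of the glued graph at joined assignments is the product of the pieces' vertex factors.**
[cite: Balaban1983Higgs3, (1.6)–(1.15) pp.413–414] -/
theorem vertexFactor_glue (V₁ : Rules G₁ SF VF OF) (V₂ : Rules G₂ SF VF OF) (bS : IS → SF) (bV : IV → VF) (bO : IO → OF)
    (α₁ : SLeg G₁.kind → IS) (α₂ : SLeg G₂.kind → IS) (β₁ : VLeg G₁.kind → IV) (β₂ : VLeg G₂.kind → IV)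
    (ο₁ : OLeg G₁.kind → IO) (ο₂ : OLeg G₂.kind → IO) :
    vertexFactor (G := GG) (glueRules V₁ V₂) bS bV bO (joinS α₁ α₂) (joinV β₁ β₂) (joinO ο₁ ο₂) =
      vertexFactor V₁ bS bV bO α₁ β₁ ο₁ * vertexFactor V₂ bS bV bO α₂ β₂ ο₂ := by
  unfold vertexFactor
  rw [Fin.prod_univ_add]
  congr 1
  · refine Fintype.prod_congr _ _ fun i => ?_
    rw [glueRules_castAdd]
    congr 1 <;> funext j
    · exact congrArg bS (joinS_flegL α₁ α₂ ⟨i, j⟩)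
    · exact congrArg bV (joinV_flegL β₁ β₂ ⟨i, j⟩)
    · exact congrArg bO (joinO_flegL ο₁ ο₂ ⟨i, j⟩)
  · refine Fintype.prod_congr _ _ fun i => ?_
    rw [glueRules_natAdd]
    congr 1 <;> funext j
    · exact congrArg bS (joinS_flegR α₁ α₂ ⟨i, j⟩)
    · exact congrArg bV (joinV_flegR β₁ β₂ ⟨i, j⟩)
    · exact congrArg bO (joinO_flegR ο₁ ο₂ ⟨i, j⟩)

end Rules

/-! ## §5 Line kernels of the glued graph; the line factors split (the new line's kernel appears) -/

section Lines

variable {nbar : ℕ} {G₁ G₂ : Graph nbar} {a : Leg G₁.kind} {b : Leg G₂.kind} {ha : G₁.other a = none}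
  {hb : G₂.other b = none} {hab : a.2.isLeft = b.2.isLeft} (hsa : a.2.isLeft = true) (hsb : b.2.isLeft = true) {IS IV IO : Type*}

local notation "GG" => glue G₁ G₂ a b ha hb hab

/-- The joint scalar pair kernel of the glued graph on its own φ′-legs: old kernels on old lines (FILE K1's `pairK`), `Knew` on the
new line read from `a` to `b`. [cite: Balaban1983Higgs3, (1.21) p.416] -/
def pairKS (Ks₁ : SLine G₁ → IS → IS → ℝ) (Ks₂ : SLine G₂ → IS → IS → ℝ) (Knew : IS → IS → ℝ) :
    SLeg (Fin.append G₁.kind G₂.kind) → SLeg (Fin.append G₁.kind G₂.kind) → IS → IS → ℝ :=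
  fun z z' => jointK (pairK (sPairing G₁) sRank Ks₁) (pairK (sPairing G₂) sRank Ks₂) Knew
    ((flegEquiv VertexKind.scalarLegs G₁.kind G₂.kind).symm z) ((flegEquiv VertexKind.scalarLegs G₁.kind G₂.kind).symm z')

/-- **The scalar line kernels of the glued graph** (one kernel per line of `glue G₁ G₂ a b`, in FILE 1's shape): the kernel of an
old line is the old kernel read in the glued graph's orientation of that line, the kernel of the new line is `Knew` from `a` to `b`.
[cite: Balaban1983Higgs3, (1.21) p.416] -/
def glueKs (Ks₁ : SLine G₁ → IS → IS → ℝ) (Ks₂ : SLine G₂ → IS → IS → ℝ) (Knew : IS → IS → ℝ) :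
    SLine GG → IS → IS → ℝ :=
  lineK (sPairing GG) sRank (pairKS Ks₁ Ks₂ Knew)

/-- The joint vector pair kernel of the glued graph (no new vector line). [cite: Balaban1983Higgs3, (1.21) p.416] -/
def pairKV (Kv₁ : VLine G₁ → IV → IV → ℝ) (Kv₂ : VLine G₂ → IV → IV → ℝ) :
    VLeg (Fin.append G₁.kind G₂.kind) → VLeg (Fin.append G₁.kind G₂.kind) → IV → IV → ℝ :=
  fun z z' => jointK (pairK (vPairing G₁) vRank Kv₁) (pairK (vPairing G₂) vRank Kv₂) (fun _ _ => 1)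
    ((flegEquiv VertexKind.vectorLegs G₁.kind G₂.kind).symm z) ((flegEquiv VertexKind.vectorLegs G₁.kind G₂.kind).symm z')

/-- **The vector line kernels of the glued graph**: the old kernels in the glued orientation. [cite: Balaban1983Higgs3, (1.21) p.416] -/
def glueKv (Kv₁ : VLine G₁ → IV → IV → ℝ) (Kv₂ : VLine G₂ → IV → IV → ℝ) : VLine GG → IV → IV → ℝ :=
  lineK (vPairing GG) vRank (pairKV Kv₁ Kv₂)

/-- The joint output pair kernel (no new output pair). [cite: Balaban1983Higgs3, (1.18) p.415] -/
def pairKO (Po₁ : OutPairing G₁) (Po₂ : OutPairing G₂) (Ko₁ : Po₁.Line oRank → IO → IO → ℝ)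
    (Ko₂ : Po₂.Line oRank → IO → IO → ℝ) :
    OLeg (Fin.append G₁.kind G₂.kind) → OLeg (Fin.append G₁.kind G₂.kind) → IO → IO → ℝ :=
  fun z z' => jointK (pairK Po₁ oRank Ko₁) (pairK Po₂ oRank Ko₂) (fun _ _ => 1)
    ((flegEquiv outSlots G₁.kind G₂.kind).symm z) ((flegEquiv outSlots G₁.kind G₂.kind).symm z')

/-- **The (1.18) output pair kernels of the glued graph**: the old kernels in the glued orientation. [cite: Balaban1983Higgs3, (1.18) p.415] -/
def glueKo (Po₁ : OutPairing G₁) (Po₂ : OutPairing G₂) (Ko₁ : Po₁.Line oRank → IO → IO → ℝ)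
    (Ko₂ : Po₂.Line oRank → IO → IO → ℝ) : (gluePo (hab := hab) (ha := ha) (hb := hb) Po₁ Po₂).Line oRank → IO → IO → ℝ :=
  lineK (gluePo Po₁ Po₂) oRank (pairKO Po₁ Po₂ Ko₁ Ko₂)

/-- **The scalar line factor of the glued graph at a joined assignment = the NEW LINE's kernel between the indices of `a` and `b`
× the scalar line factors of the two pieces.** [cite: Balaban1983Higgs3, (1.21) p.416] -/
theorem sLineFactor_glue (Ks₁ : SLine G₁ → IS → IS → ℝ) (Ks₂ : SLine G₂ → IS → IS → ℝ) (Knew : IS → IS → ℝ)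
    (α₁ : SLeg G₁.kind → IS) (α₂ : SLeg G₂.kind → IS) :
    sLineFactor (G := GG) (glueKs Ks₁ Ks₂ Knew) (joinS α₁ α₂) =
      Knew (α₁ (sleg a hsa)) (α₂ (sleg b hsb)) * (sLineFactor Ks₁ α₁ * sLineFactor Ks₂ α₂) := by
  have hflip : FlipSymm (sPairing GG) (pairKS (G₁ := G₁) (G₂ := G₂) Ks₁ Ks₂ Knew) :=
    flipSymm_transport (spartner_glue (ha := ha) (hb := hb) (hab := hab) hsa hsb)
      (jointK_flipSymm_glueP _ _ _ _ (pairK_flipSymm _ _ sRank_injective Ks₁) (pairK_flipSymm _ _ sRank_injective Ks₂) Knew)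
  have hr' : Function.Injective (sumRank (sRank (kind := G₁.kind)) (sRank (kind := G₂.kind)) ∘ (eS (G₁ := G₁) (G₂ := G₂)).symm) :=
    (sumRank_injective sRank_injective sRank_injective).comp (eS (G₁ := G₁) (G₂ := G₂)).symm.injective
  calc sLineFactor (G := GG) (glueKs Ks₁ Ks₂ Knew) (joinS α₁ α₂)
      = lineProd (sPairing GG) sRank (pairKS Ks₁ Ks₂ Knew) (joinS α₁ α₂) := rfl
    _ = lineProd (sPairing GG) (sumRank sRank sRank ∘ (eS (G₁ := G₁) (G₂ := G₂)).symm) (pairKS Ks₁ Ks₂ Knew) (joinS α₁ α₂) :=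
        lineProd_rank_indep _ sRank_injective hr' hflip _
    _ = lineProd (jointS (ha := ha) (hb := hb) hsa hsb) (sumRank sRank sRank)
          (fun w w' => pairKS Ks₁ Ks₂ Knew (eS w) (eS w')) (joinS α₁ α₂ ∘ eS) :=
        lineProd_transport (spartner_glue (ha := ha) (hb := hb) (hab := hab) hsa hsb) (fun w => by simp) _ _
    _ = lineProd (jointS (ha := ha) (hb := hb) hsa hsb) (sumRank sRank sRank)
          (jointK (pairK (sPairing G₁) sRank Ks₁) (pairK (sPairing G₂) sRank Ks₂) Knew) (Sum.elim α₁ α₂) := by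
        congr 1
        · funext w w'; simp [pairKS]
        · funext w; simp
    _ = Knew (α₁ (sleg a hsa)) (α₂ (sleg b hsb)) * (sLineFactor Ks₁ α₁ * sLineFactor Ks₂ α₂) := by
        rw [lineProd_glueP_jointK]
        simp only [Sum.elim_inl, Sum.elim_inr]
        congr 2
        · exact (prod_line_eq_lineProd_pairK (sPairing G₁) sRank Ks₁ α₁).symm
        · exact (prod_line_eq_lineProd_pairK (sPairing G₂) sRank Ks₂ α₂).symm

include hsa hsb in
/-- **The vector line factor of the glued graph at a joined assignment is the product of the pieces' vector line factors.**
[cite: Balaban1983Higgs3, (1.21) p.416] -/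
theorem vLineFactor_glue (Kv₁ : VLine G₁ → IV → IV → ℝ) (Kv₂ : VLine G₂ → IV → IV → ℝ)
    (β₁ : VLeg G₁.kind → IV) (β₂ : VLeg G₂.kind → IV) :
    vLineFactor (G := GG) (glueKv Kv₁ Kv₂) (joinV β₁ β₂) = vLineFactor Kv₁ β₁ * vLineFactor Kv₂ β₂ := by
  have hflip : FlipSymm (vPairing GG) (pairKV (G₁ := G₁) (G₂ := G₂) Kv₁ Kv₂) :=
    flipSymm_transport (vpartner_glue (ha := ha) (hb := hb) (hab := hab) hsa hsb)
      (jointK_flipSymm_sumP _ _ (pairK_flipSymm _ _ vRank_injective Kv₁) (pairK_flipSymm _ _ vRank_injective Kv₂) _)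
  have hr' : Function.Injective (sumRank (vRank (kind := G₁.kind)) (vRank (kind := G₂.kind)) ∘ (eV (G₁ := G₁) (G₂ := G₂)).symm) :=
    (sumRank_injective vRank_injective vRank_injective).comp (eV (G₁ := G₁) (G₂ := G₂)).symm.injective
  calc vLineFactor (G := GG) (glueKv Kv₁ Kv₂) (joinV β₁ β₂)
      = lineProd (vPairing GG) vRank (pairKV Kv₁ Kv₂) (joinV β₁ β₂) := rfl
    _ = lineProd (vPairing GG) (sumRank vRank vRank ∘ (eV (G₁ := G₁) (G₂ := G₂)).symm) (pairKV Kv₁ Kv₂) (joinV β₁ β₂) :=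
        lineProd_rank_indep _ vRank_injective hr' hflip _
    _ = lineProd ((vPairing G₁).sumP (vPairing G₂)) (sumRank vRank vRank)
          (fun w w' => pairKV Kv₁ Kv₂ (eV w) (eV w')) (joinV β₁ β₂ ∘ eV) :=
        lineProd_transport (vpartner_glue (ha := ha) (hb := hb) (hab := hab) hsa hsb) (fun w => by simp) _ _
    _ = lineProd ((vPairing G₁).sumP (vPairing G₂)) (sumRank vRank vRank)
          (jointK (pairK (vPairing G₁) vRank Kv₁) (pairK (vPairing G₂) vRank Kv₂) fun _ _ => 1) (Sum.elim β₁ β₂) := by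
        congr 1
        · funext w w'; simp [pairKV]
        · funext w; simp
    _ = vLineFactor Kv₁ β₁ * vLineFactor Kv₂ β₂ := by
        rw [lineProd_sumP_jointK]
        congr 1
        · exact (prod_line_eq_lineProd_pairK (vPairing G₁) vRank Kv₁ β₁).symm
        · exact (prod_line_eq_lineProd_pairK (vPairing G₂) vRank Kv₂ β₂).symm

omit hsa hsb in
/-- **The (1.18) output pair factor of the glued graph at a joined assignment is the product of the pieces' factors.**
[cite: Balaban1983Higgs3, (1.18) p.415] -/
theorem oLineFactor_glue (Po₁ : OutPairing G₁) (Po₂ : OutPairing G₂) (Ko₁ : Po₁.Line oRank → IO → IO → ℝ)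
    (Ko₂ : Po₂.Line oRank → IO → IO → ℝ) (ο₁ : OLeg G₁.kind → IO) (ο₂ : OLeg G₂.kind → IO) :
    oLineFactor (G := GG) (gluePo Po₁ Po₂) (glueKo Po₁ Po₂ Ko₁ Ko₂) (joinO ο₁ ο₂) =
      oLineFactor Po₁ Ko₁ ο₁ * oLineFactor Po₂ Ko₂ ο₂ := by
  have he : ∀ w, (gluePo (ha := ha) (hb := hb) (hab := hab) Po₁ Po₂).other (eO w) = ((Po₁.sumP Po₂).other w).map eO :=
    fun w => transportP_other_apply _ _ w
  have hflip : FlipSymm (gluePo (ha := ha) (hb := hb) (hab := hab) Po₁ Po₂) (pairKO (G₁ := G₁) (G₂ := G₂) Po₁ Po₂ Ko₁ Ko₂) :=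
    flipSymm_transport he (jointK_flipSymm_sumP _ _ (pairK_flipSymm _ _ oRank_injective Ko₁)
      (pairK_flipSymm _ _ oRank_injective Ko₂) _)
  have hr' : Function.Injective (sumRank (oRank (kind := G₁.kind)) (oRank (kind := G₂.kind)) ∘ (eO (G₁ := G₁) (G₂ := G₂)).symm) :=
    (sumRank_injective oRank_injective oRank_injective).comp (eO (G₁ := G₁) (G₂ := G₂)).symm.injective
  calc oLineFactor (G := GG) (gluePo Po₁ Po₂) (glueKo Po₁ Po₂ Ko₁ Ko₂) (joinO ο₁ ο₂)
      = lineProd (gluePo (ha := ha) (hb := hb) (hab := hab) Po₁ Po₂) oRank (pairKO Po₁ Po₂ Ko₁ Ko₂) (joinO ο₁ ο₂) := rfl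
    _ = lineProd (gluePo (ha := ha) (hb := hb) (hab := hab) Po₁ Po₂) (sumRank oRank oRank ∘ (eO (G₁ := G₁) (G₂ := G₂)).symm)
          (pairKO Po₁ Po₂ Ko₁ Ko₂) (joinO ο₁ ο₂) :=
        lineProd_rank_indep _ oRank_injective hr' hflip _
    _ = lineProd (Po₁.sumP Po₂) (sumRank oRank oRank)
          (fun w w' => pairKO Po₁ Po₂ Ko₁ Ko₂ (eO w) (eO w')) (joinO ο₁ ο₂ ∘ eO) :=
        lineProd_transport he (fun w => by simp) _ _
    _ = lineProd (Po₁.sumP Po₂) (sumRank oRank oRank)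
          (jointK (pairK Po₁ oRank Ko₁) (pairK Po₂ oRank Ko₂) fun _ _ => 1) (Sum.elim ο₁ ο₂) := by
        congr 1
        · funext w w'; simp [pairKO]
        · funext w; simp
    _ = oLineFactor Po₁ Ko₁ ο₁ * oLineFactor Po₂ Ko₂ ο₂ := by
        rw [lineProd_sumP_jointK]
        congr 1
        · exact (prod_line_eq_lineProd_pairK Po₁ oRank Ko₁ ο₁).symm
        · exact (prod_line_eq_lineProd_pairK Po₂ oRank Ko₂ ο₂).symm

end Lines

/-! ## §6 The external legs of the glued graph -/

section External

variable {nbar : ℕ} {G₁ G₂ : Graph nbar} {a : Leg G₁.kind} {b : Leg G₂.kind} {ha : G₁.other a = none}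
  {hb : G₂.other b = none} {hab : a.2.isLeft = b.2.isLeft} (hsa : a.2.isLeft = true) (hsb : b.2.isLeft = true)

local notation "GG" => glue G₁ G₂ a b ha hb hab

/-- **The external φ′-legs of `G₁` other than `a` are external φ′-legs of the glued graph.** [cite: Balaban1983Higgs3, (1.21) p.416] -/
def extL (x : {x : ExtSLeg G₁ // x.1 ≠ sleg a hsa}) : ExtSLeg GG :=
  ⟨flegL VertexKind.scalarLegs G₁.kind G₂.kind x.1.1, by
    have h := spartner_glue (ha := ha) (hb := hb) (hab := hab) hsa hsb (Sum.inl x.1.1)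
    rw [(glueP_other_inl_eq_none_iff _ _ _ _ x.1.1).2 ⟨x.2, x.1.2⟩] at h
    simpa using h⟩

/-- **The external φ′-legs of `G₂` other than `b` are external φ′-legs of the glued graph.** [cite: Balaban1983Higgs3, (1.21) p.416] -/
def extR (y : {y : ExtSLeg G₂ // y.1 ≠ sleg b hsb}) : ExtSLeg GG :=
  ⟨flegR VertexKind.scalarLegs G₁.kind G₂.kind y.1.1, by
    have h := spartner_glue (ha := ha) (hb := hb) (hab := hab) hsa hsb (Sum.inr y.1.1)
    rw [(glueP_other_inr_eq_none_iff _ _ _ _ y.1.1).2 ⟨y.2, y.1.2⟩] at h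
    simpa using h⟩

/-- **The external A′-legs of `G₁` are external A′-legs of the glued graph.** [cite: Balaban1983Higgs3, (1.21) p.416] -/
def extVL (x : ExtVLeg G₁) : ExtVLeg GG :=
  ⟨flegL VertexKind.vectorLegs G₁.kind G₂.kind x.1, by
    have h := vpartner_glue (ha := ha) (hb := hb) (hab := hab) hsa hsb (Sum.inl x.1)
    rw [sumP_other_inl, x.2] at h
    simpa using h⟩

/-- **The external A′-legs of `G₂` are external A′-legs of the glued graph.** [cite: Balaban1983Higgs3, (1.21) p.416] -/
def extVR (y : ExtVLeg G₂) : ExtVLeg GG :=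
  ⟨flegR VertexKind.vectorLegs G₁.kind G₂.kind y.1, by
    have h := vpartner_glue (ha := ha) (hb := hb) (hab := hab) hsa hsb (Sum.inr y.1)
    rw [sumP_other_inr, y.2] at h
    simpa using h⟩

/-- **The unpaired outputs of `G₁` are unpaired outputs of the glued graph.** [cite: Balaban1983Higgs3, (1.18) p.415] -/
def extOL (Po₁ : OutPairing G₁) (Po₂ : OutPairing G₂) (x : Po₁.Ext) : (gluePo (ha := ha) (hb := hb) (hab := hab) Po₁ Po₂).Ext :=
  ⟨flegL outSlots G₁.kind G₂.kind x.1, by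
    have h := transportP_other_apply (Po₁.sumP Po₂) (eO (G₁ := G₁) (G₂ := G₂)) (Sum.inl x.1)
    rw [sumP_other_inl, x.2] at h
    simpa [gluePo] using h⟩

/-- **The unpaired outputs of `G₂` are unpaired outputs of the glued graph.** [cite: Balaban1983Higgs3, (1.18) p.415] -/
def extOR (Po₁ : OutPairing G₁) (Po₂ : OutPairing G₂) (y : Po₂.Ext) : (gluePo (ha := ha) (hb := hb) (hab := hab) Po₁ Po₂).Ext :=
  ⟨flegR outSlots G₁.kind G₂.kind y.1, by
    have h := transportP_other_apply (Po₁.sumP Po₂) (eO (G₁ := G₁) (G₂ := G₂)) (Sum.inr y.1)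
    rw [sumP_other_inr, y.2] at h
    simpa [gluePo] using h⟩

variable {IS IV IO : Type*}

/-- kernel: a joined assignment read at an embedded external leg of `G₁`. [cite: Balaban1983Higgs3, (1.21) p.416] -/
@[simp] theorem joinS_extL (α₁ : SLeg G₁.kind → IS) (α₂ : SLeg G₂.kind → IS) (x : {x : ExtSLeg G₁ // x.1 ≠ sleg a hsa}) :
    joinS α₁ α₂ (extL (ha := ha) (hb := hb) (hab := hab) hsa hsb x).1 = α₁ x.1.1 :=
  joinS_flegL α₁ α₂ _

/-- kernel: a joined assignment read at an embedded external leg of `G₂`. [cite: Balaban1983Higgs3, (1.21) p.416] -/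
@[simp] theorem joinS_extR (α₁ : SLeg G₁.kind → IS) (α₂ : SLeg G₂.kind → IS) (y : {y : ExtSLeg G₂ // y.1 ≠ sleg b hsb}) :
    joinS α₁ α₂ (extR (ha := ha) (hb := hb) (hab := hab) hsa hsb y).1 = α₂ y.1.1 :=
  joinS_flegR α₁ α₂ _

/-- kernel. [cite: Balaban1983Higgs3, (1.21) p.416] -/
@[simp] theorem joinV_extVL (β₁ : VLeg G₁.kind → IV) (β₂ : VLeg G₂.kind → IV) (x : ExtVLeg G₁) :
    joinV β₁ β₂ (extVL (ha := ha) (hb := hb) (hab := hab) hsa hsb x).1 = β₁ x.1 :=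
  joinV_flegL β₁ β₂ _

/-- kernel. [cite: Balaban1983Higgs3, (1.21) p.416] -/
@[simp] theorem joinV_extVR (β₁ : VLeg G₁.kind → IV) (β₂ : VLeg G₂.kind → IV) (y : ExtVLeg G₂) :
    joinV β₁ β₂ (extVR (ha := ha) (hb := hb) (hab := hab) hsa hsb y).1 = β₂ y.1 :=
  joinV_flegR β₁ β₂ _

/-- kernel. [cite: Balaban1983Higgs3, (1.18) p.415] -/
@[simp] theorem joinO_extOL (Po₁ : OutPairing G₁) (Po₂ : OutPairing G₂) (ο₁ : OLeg G₁.kind → IO) (ο₂ : OLeg G₂.kind → IO)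
    (x : Po₁.Ext) : joinO ο₁ ο₂ (extOL (ha := ha) (hb := hb) (hab := hab) Po₁ Po₂ x).1 = ο₁ x.1 :=
  joinO_flegL ο₁ ο₂ _

/-- kernel. [cite: Balaban1983Higgs3, (1.18) p.415] -/
@[simp] theorem joinO_extOR (Po₁ : OutPairing G₁) (Po₂ : OutPairing G₂) (ο₁ : OLeg G₁.kind → IO) (ο₂ : OLeg G₂.kind → IO)
    (y : Po₂.Ext) : joinO ο₁ ο₂ (extOR (ha := ha) (hb := hb) (hab := hab) Po₁ Po₂ y).1 = ο₂ y.1 :=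
  joinO_flegR ο₁ ο₂ _

end External

/-! ## §7 The cutting rule -/

section Cutting

variable {nbar : ℕ} {G : Graph nbar} {SF VF OF : Type*} {IS IV IO : Type*} [Fintype IS] [Fintype IV] [Fintype IO]

/-- kernel: E(G, ·) is LINEAR in the external scalar function — a finite linear combination of external functions gives the linear
combination of the expressions (FILE 1's `amp_add_extS`/`amp_smul_extS` in the summed form used below). [cite: Balaban1983Higgs3, p.419] -/
theorem amp_sum_mul_extS {T : Type*} [Fintype T] (V : Rules G SF VF OF) (bS : IS → SF) (bV : IV → VF) (bO : IO → OF)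
    (Po : OutPairing G) (Ks : SLine G → IS → IS → ℝ) (Kv : VLine G → IV → IV → ℝ) (Ko : Po.Line oRank → IO → IO → ℝ)
    (c : T → ℝ) (Φ : T → (ExtSLeg G → IS) → ℝ) (A : (ExtVLeg G → IV) → ℝ) (Ψ : (Po.Ext → IO) → ℝ) :
    ∑ t, c t * amp V bS bV bO Po Ks Kv Ko (Φ t) A Ψ = amp V bS bV bO Po Ks Kv Ko (fun γ => ∑ t, c t * Φ t γ) A Ψ := by
  unfold amp
  simp only [Finset.mul_sum]
  rw [Finset.sum_comm]
  refine Finset.sum_congr rfl fun α _ => ?_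
  rw [Finset.sum_comm]
  refine Finset.sum_congr rfl fun β _ => ?_
  rw [Finset.sum_comm]
  refine Finset.sum_congr rfl fun ο _ => ?_
  rw [Finset.sum_mul, Finset.sum_mul, Finset.mul_sum, Finset.sum_mul]
  refine Finset.sum_congr rfl fun t _ => ?_
  ring

/-- kernel: the same linearity with the coefficients written on the right. [cite: Balaban1983Higgs3, p.419] -/
theorem amp_sum_mul_extS' {T : Type*} [Fintype T] (V : Rules G SF VF OF) (bS : IS → SF) (bV : IV → VF) (bO : IO → OF)
    (Po : OutPairing G) (Ks : SLine G → IS → IS → ℝ) (Kv : VLine G → IV → IV → ℝ) (Ko : Po.Line oRank → IO → IO → ℝ)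
    (c : T → ℝ) (Φ : T → (ExtSLeg G → IS) → ℝ) (A : (ExtVLeg G → IV) → ℝ) (Ψ : (Po.Ext → IO) → ℝ) :
    ∑ t, amp V bS bV bO Po Ks Kv Ko (Φ t) A Ψ * c t = amp V bS bV bO Po Ks Kv Ko (fun γ => ∑ t, c t * Φ t γ) A Ψ := by
  rw [← amp_sum_mul_extS]
  exact Finset.sum_congr rfl fun t _ => mul_comm _ _

/-- kernel: the Kronecker collapse `Σ_p c p · [x = p] X = c x · X`. [folklore] -/
private theorem sum_mul_ite_eq [DecidableEq IS] (c : IS → ℝ) (x : IS) (X : ℝ) :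
    ∑ p, c p * ((if x = p then (1 : ℝ) else 0) * X) = c x * X := by
  have : ∀ p, c p * ((if x = p then (1 : ℝ) else 0) * X) = if x = p then c p * X else 0 := fun p => by
    split_ifs <;> simp
  simp_rw [this, Finset.sum_ite_eq, Finset.mem_univ, if_true]

/-- kernel: reordering a sixfold finite sum (blocks of three). [folklore] -/
private theorem sum6_reorder {A₁ A₂ B₁ B₂ C₁ C₂ : Type*} [Fintype A₁] [Fintype A₂] [Fintype B₁] [Fintype B₂] [Fintype C₁] [Fintype C₂]
    (g : A₁ → A₂ → B₁ → B₂ → C₁ → C₂ → ℝ) :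
    ∑ a₁, ∑ a₂, ∑ b₁, ∑ b₂, ∑ c₁, ∑ c₂, g a₁ a₂ b₁ b₂ c₁ c₂ = ∑ a₁, ∑ b₁, ∑ c₁, ∑ a₂, ∑ b₂, ∑ c₂, g a₁ a₂ b₁ b₂ c₁ c₂ := by
  calc ∑ a₁, ∑ a₂, ∑ b₁, ∑ b₂, ∑ c₁, ∑ c₂, g a₁ a₂ b₁ b₂ c₁ c₂
      = ∑ a₁, ∑ a₂, ∑ b₁, ∑ c₁, ∑ b₂, ∑ c₂, g a₁ a₂ b₁ b₂ c₁ c₂ := by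
        refine Finset.sum_congr rfl fun _ _ => Finset.sum_congr rfl fun _ _ => Finset.sum_congr rfl fun _ _ => ?_
        exact Finset.sum_comm
    _ = ∑ a₁, ∑ b₁, ∑ a₂, ∑ c₁, ∑ b₂, ∑ c₂, g a₁ a₂ b₁ b₂ c₁ c₂ := by
        refine Finset.sum_congr rfl fun _ _ => ?_
        exact Finset.sum_comm
    _ = ∑ a₁, ∑ b₁, ∑ c₁, ∑ a₂, ∑ b₂, ∑ c₂, g a₁ a₂ b₁ b₂ c₁ c₂ := by
        refine Finset.sum_congr rfl fun _ _ => Finset.sum_congr rfl fun _ _ => ?_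
        exact Finset.sum_comm

variable {G₁ G₂ : Graph nbar} {a : Leg G₁.kind} {b : Leg G₂.kind} {ha : G₁.other a = none} {hb : G₂.other b = none}
  {hab : a.2.isLeft = b.2.isLeft} (hsa : a.2.isLeft = true) (hsb : b.2.isLeft = true)

local notation "GG" => glue G₁ G₂ a b ha hb hab

/-- **THE CUTTING RULE for the glued graph (the step behind (1.21)'s `C₀^ε X C₀^ε`)**: with the vertex rules of the two pieces,
the old line kernels, the kernel `Knew` of the new line a—b, and external data `Φ`, `A`, `Ψ` of product form (`hΦ`, `hA`, `hΨ`;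
external φ′-legs of the glued graph = those of `G₁` other than `a` and those of `G₂` other than `b`; A′-legs and unpaired outputs
those of both pieces),
E(glue G₁ G₂ a b) = Σ_{p,q} Knew p q · E(G₁)[a ↦ δ_p] · E(G₂)[b ↦ δ_q] — p26's `amp` of each piece with its external function
restricted (by the indicator `[γ a = p]`) to the assignments giving the exposed leg the index `p`, resp. `q`: cutting the new line
exposes the two φ′-legs, and the line's propagator entry contracts them (p. 414 *"each pair is replaced by the corresponding
propagator"*, read for the one pair a—b). [cite: Balaban1983Higgs3, (1.21) p.416] [cite: Balaban1983Higgs3, p.414] -/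
theorem amp_glue [DecidableEq IS] (V₁ : Rules G₁ SF VF OF) (V₂ : Rules G₂ SF VF OF) (bS : IS → SF) (bV : IV → VF)
    (bO : IO → OF) (Po₁ : OutPairing G₁) (Po₂ : OutPairing G₂) (Ks₁ : SLine G₁ → IS → IS → ℝ)
    (Ks₂ : SLine G₂ → IS → IS → ℝ) (Knew : IS → IS → ℝ) (Kv₁ : VLine G₁ → IV → IV → ℝ) (Kv₂ : VLine G₂ → IV → IV → ℝ)
    (Ko₁ : Po₁.Line oRank → IO → IO → ℝ) (Ko₂ : Po₂.Line oRank → IO → IO → ℝ)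
    (Φ : (ExtSLeg GG → IS) → ℝ) (A : (ExtVLeg GG → IV) → ℝ) (Ψ : ((gluePo (ha := ha) (hb := hb) (hab := hab) Po₁ Po₂).Ext → IO) → ℝ)
    (F₁ : ({x : ExtSLeg G₁ // x.1 ≠ sleg a hsa} → IS) → ℝ) (F₂ : ({y : ExtSLeg G₂ // y.1 ≠ sleg b hsb} → IS) → ℝ)
    (A₁ : (ExtVLeg G₁ → IV) → ℝ) (A₂ : (ExtVLeg G₂ → IV) → ℝ) (Ψ₁ : (Po₁.Ext → IO) → ℝ) (Ψ₂ : (Po₂.Ext → IO) → ℝ)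
    (hΦ : ∀ γ, Φ γ = F₁ (fun x => γ (extL (ha := ha) (hb := hb) (hab := hab) hsa hsb x)) *
      F₂ (fun y => γ (extR (ha := ha) (hb := hb) (hab := hab) hsa hsb y)))
    (hA : ∀ ζ, A ζ = A₁ (fun x => ζ (extVL (ha := ha) (hb := hb) (hab := hab) hsa hsb x)) *
      A₂ (fun y => ζ (extVR (ha := ha) (hb := hb) (hab := hab) hsa hsb y)))
    (hΨ : ∀ ξ, Ψ ξ = Ψ₁ (fun x => ξ (extOL (ha := ha) (hb := hb) (hab := hab) Po₁ Po₂ x)) *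
      Ψ₂ (fun y => ξ (extOR (ha := ha) (hb := hb) (hab := hab) Po₁ Po₂ y))) :
    amp (G := GG) (glueRules V₁ V₂) bS bV bO (gluePo Po₁ Po₂) (glueKs Ks₁ Ks₂ Knew) (glueKv Kv₁ Kv₂) (glueKo Po₁ Po₂ Ko₁ Ko₂)
        Φ A Ψ =
      ∑ p : IS, ∑ q : IS, Knew p q *
        (amp V₁ bS bV bO Po₁ Ks₁ Kv₁ Ko₁ (fun γ₁ => (if γ₁ ⟨sleg a hsa, spartner_sleg ha hsa⟩ = p then 1 else 0) *
            F₁ (fun x => γ₁ x.1)) A₁ Ψ₁ *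
          amp V₂ bS bV bO Po₂ Ks₂ Kv₂ Ko₂ (fun γ₂ => (if γ₂ ⟨sleg b hsb, spartner_sleg hb hsb⟩ = q then 1 else 0) *
            F₂ (fun y => γ₂ y.1)) A₂ Ψ₂) := by
  obtain rfl : Φ = fun γ => F₁ (fun x => γ (extL (ha := ha) (hb := hb) (hab := hab) hsa hsb x)) *
      F₂ (fun y => γ (extR (ha := ha) (hb := hb) (hab := hab) hsa hsb y)) := funext hΦ
  obtain rfl : A = fun ζ => A₁ (fun x => ζ (extVL (ha := ha) (hb := hb) (hab := hab) hsa hsb x)) *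
      A₂ (fun y => ζ (extVR (ha := ha) (hb := hb) (hab := hab) hsa hsb y)) := funext hA
  obtain rfl : Ψ = fun ξ => Ψ₁ (fun x => ξ (extOL (ha := ha) (hb := hb) (hab := hab) Po₁ Po₂ x)) *
      Ψ₂ (fun y => ξ (extOR (ha := ha) (hb := hb) (hab := hab) Po₁ Po₂ y)) := funext hΨ
  -- the right-hand side: absorb `q` into the amplitude of `G₂`, then `p` into the amplitude of `G₁`
  have hq : ∀ p, ∑ q, Knew p q *
      amp V₂ bS bV bO Po₂ Ks₂ Kv₂ Ko₂ (fun γ₂ => (if γ₂ ⟨sleg b hsb, spartner_sleg hb hsb⟩ = q then 1 else 0) *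
        F₂ (fun y => γ₂ y.1)) A₂ Ψ₂ =
      amp V₂ bS bV bO Po₂ Ks₂ Kv₂ Ko₂ (fun γ₂ => Knew p (γ₂ ⟨sleg b hsb, spartner_sleg hb hsb⟩) *
        F₂ (fun y => γ₂ y.1)) A₂ Ψ₂ := fun p => by
    rw [amp_sum_mul_extS]
    congr 1
    funext γ₂
    exact sum_mul_ite_eq (fun q => Knew p q) _ _
  have hpq : ∀ p q : IS, ∀ X Y : ℝ, Knew p q * (X * Y) = X * (Knew p q * Y) := fun p q X Y => by ring
  simp_rw [hpq, ← Finset.mul_sum, hq]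
  have hp : ∑ p, amp V₁ bS bV bO Po₁ Ks₁ Kv₁ Ko₁ (fun γ₁ => (if γ₁ ⟨sleg a hsa, spartner_sleg ha hsa⟩ = p then 1 else 0) *
        F₁ (fun x => γ₁ x.1)) A₁ Ψ₁ *
      amp V₂ bS bV bO Po₂ Ks₂ Kv₂ Ko₂ (fun γ₂ => Knew p (γ₂ ⟨sleg b hsb, spartner_sleg hb hsb⟩) *
        F₂ (fun y => γ₂ y.1)) A₂ Ψ₂ =
      amp V₁ bS bV bO Po₁ Ks₁ Kv₁ Ko₁ (fun γ₁ =>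
        amp V₂ bS bV bO Po₂ Ks₂ Kv₂ Ko₂ (fun γ₂ => Knew (γ₁ ⟨sleg a hsa, spartner_sleg ha hsa⟩)
          (γ₂ ⟨sleg b hsb, spartner_sleg hb hsb⟩) * F₂ (fun y => γ₂ y.1)) A₂ Ψ₂ * F₁ (fun x => γ₁ x.1)) A₁ Ψ₁ := by
    rw [amp_sum_mul_extS']
    congr 1
    funext γ₁
    exact sum_mul_ite_eq (fun p => amp V₂ bS bV bO Po₂ Ks₂ Kv₂ Ko₂ (fun γ₂ =>
      Knew p (γ₂ ⟨sleg b hsb, spartner_sleg hb hsb⟩) * F₂ (fun y => γ₂ y.1)) A₂ Ψ₂) _ _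
  rw [hp]
  -- both sides as sixfold sums over the pieces' assignments
  unfold amp
  rw [sum_joinS]
  simp_rw [sum_joinV, sum_joinO, vertexFactor_glue, sLineFactor_glue hsa hsb, vLineFactor_glue hsa hsb, oLineFactor_glue,
    joinS_extL, joinS_extR, joinV_extVL, joinV_extVR, joinO_extOL, joinO_extOR]
  rw [sum6_reorder]
  refine Finset.sum_congr rfl fun α₁ _ => Finset.sum_congr rfl fun β₁ _ => Finset.sum_congr rfl fun ο₁ _ => ?_
  simp only [Finset.sum_mul, Finset.mul_sum]
  refine Finset.sum_congr rfl fun α₂ _ => Finset.sum_congr rfl fun β₂ _ => Finset.sum_congr rfl fun ο₂ _ => ?_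
  ring

end Cutting

end Literature.MathematicalPhysics.QuantumFieldTheory.Balaban1983to89.B3GraphGlueAmplitude
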